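import Summits.QuantumFields.YangMills.Theorems.UnitScaleTiltProp7FrameResponseAtChartPoint
import Summits.QuantumFields.YangMills.Theorems.UnitScaleTiltProp7ChartGaugeCovarianceDeriv
import Summits.QuantumFields.YangMills.Theorems.UnitScaleTiltProp7TwistedSliceTangent
import Summits.QuantumFields.YangMills.Theorems.UnitScaleTiltProp7SectET3DeltaOneT3JTerm
import Summits.QuantumFields.YangMills.Theorems.UnitScaleTiltProp7CmapTwSymInputs
import HarnessLib

/-!
# (q-gauge) SUPPLIER, S1-SPEC (2) — F4: **THE POINTWISE SECOND-ORDER GAUGE-COVARIANCE IDENTITY (2) OF THE RE-BASED TWISTED AVERAGE, AT A PRINTED-REGULAR BACKGROUND** —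
# `avgHess U₀ Y (D_{U₀}N)(c) = −½·QTwS U₀ ([N + AdN′, Y])(c) + ½·[P_c, QTwS U₀ Y (c)] + (κY(ĉ₋) − Ū₀(ĉ)κY(ĉ₊)Ū₀(ĉ)⁻¹)`, the `Y`-derivative of ✓`Prop7ChartGaugeCovarianceDeriv.fderiv_logChartTwS_gaugeVelocity_apply`
# at the chart origin: the displayed letter `h2` of ✓`Prop7AvgHessGaugeIdentityNormReading` §2–§4 with `κY` PRODUCED (F3's chart×gauge mixed derivative) and `ns` ANY averaging sequence of `N`

Cell `ym3-torus` (HUMAN RULING D-0037, YM ladder rung R3 — SU(2) YM₃ on T³: NOT d = 4, NOT infinite volume, NOT a mass gap, NOT Clay).  Width seat `ym3-torus-px19` (gen 15); the assembly of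
S1-SPEC (2) over F1 (`D²log(1)`), F2 (chart curve through `A₀`, `V`, `V′`), F3 (FR₁ at chart points, `κY`).  THEOREMS ONLY (0 `def`, 0 `sorry`, default heartbeats); `--supports stmt-QuantumFields-19200
--as helper`; count-neutral; NO claim on crux ∕ stub ∕ registry.

THE MATHEMATICS.  For complex `s` near `0` put `A₀ = sY`.  The first-order law ✓p769222 at `A₀` (its five letters inhabited on the ball: `hS` ✓`analyticOnNhd_logChartTwS`, `Ac`∕`hcopy` F2, `hFr` F3, `hL`
✓`hasFDerivAt_mlog_injective`) reads `DS(sY)[V(sY)](c) = Dlog(D_s)[κ_s(ĉ₋)·D_s − D_s·Ū₀(ĉ)κ_s(ĉ₊)Ū₀(ĉ)⁻¹]`, `S = logChartTwS U₀`, `D_s = U̿^{twS}(sY)(c)`, `κ_s(x) = v_s(x)⁻¹(N(x̂x) − vd_s(x)v_s(x)⁻¹)v_s(x)`.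
Differentiate at `s = 0`: the left side by `HasDerivAt.clm_apply` (`D(DS)(0) = avgHess U₀` by `avgHess_def`, `d∕ds V(sY) = ½·comm` F2) is `avgHess U₀ Y (D_{U₀}N)(c) + ½·QTwS U₀ (comm)(c)`; the right
side by F1 ★★`hasDerivAt_fderiv_mlog_comp_apply` (`D_0 = 1`, `∂_s D_s|₀ = QTwS U₀ Y (c) =: σ`, `D²log(1)[σ, Z₀] = −½(σZ₀ + Z₀σ)`) and the product rule (`κ_0 = ns_{K−n}` F3 `kappaAt_zero`,
`κ′_0 = κY` F3 ★★★`hasDerivAt_kappaAt_smul`) is `−½(σZ₀ + Z₀σ) + κY(ĉ₋) + ns(ĉ₋)σ − σ·Ū₀ns(ĉ₊)Ū₀⁻¹ − Ū₀κY(ĉ₊)Ū₀⁻¹`, `Z₀ = ns(ĉ₋) − Ū₀ns(ĉ₊)Ū₀⁻¹`; uniqueness of the derivative and the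
ring identity `−½(σZ₀ + Z₀σ) + ns(ĉ₋)σ − σŪ₀ns(ĉ₊)Ū₀⁻¹ = ½[P_c, σ]` (`P_c = ns(ĉ₋) + Ū₀ns(ĉ₊)Ū₀⁻¹`) give (2).  Abelian check: all commutators vanish and the gauge-direction Hessian is the coarse
gradient of the mixed derivative `κY`, as it must be.

WHAT IS PROVED (namespace `…Theorems.Prop7AvgHessGaugePointwiseIdentity`; member `F`, `h : n ≤ K`).
* §1 x-form readings of F3 at a top-level site `x` (frames `w_x(A) = frameAccU (K−n) U₀♭ (e^{A}U₀♭) x`): `hasDerivAt_frameAccU_gaugeCopyAt_site`, `fderiv_frameAccU_zero_gaugeDir_site`,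
  `kappaAt_zero_site`, `hasDerivAt_kappaAt_smul_site`; `solve_avgHess` (the closing ring identity, `2⁻¹` handled by `inv_smul_smul₀`).
* §2 ★★★ `avgHess_gaugeDir_apply` — (2) at `RegPr F n K ε₀ U₀`, `10¹²L³ε₀ ≤ 1`, for EVERY chart direction `Y`, gauge parameter `N`, averaging sequence `ns` of `N` and comparison bond `c`, with
  `κY(x) := (ns(x)·v′(x) − v′(x)·ns(x)) + (N(x̂x) − ns(x))·v′(x) − vd′(x)`, `v′(x) = Dw_x(0)[Y]`, `vd′(x) = D²w_x(0)[Y, D_{U₀}N] + Dw_x(0)[½·comm]`; ★★★ `h2_of_regPr` — ✓p774022's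
  letter `h2` VERBATIM (`N := δ_x⊗A`, families `ns x A`, explicit `κY Y x A`), consumable by `exact`.
HONEST SCOPE.  An identity (no estimate): «FR₂-lite» (the site-mass row of `κY`) is NOT here; `hqG`, norm_G, the 8 EX rows, EX, the crux and rung R3 are NOT proved; the Yang–Mills mass gap is NOT
proved.

References: T. Bałaban, CMP **99** (1985) 389–434 [Balaban1985BackgroundPropagators] ((3.13)–(3.16), (3.19) p.393, (3.114)–(3.115) p.418); CMP **98** (1985) 17–51 [Balaban1985Averaging] ((11) p.19,
(21) p.21, (97) p.32, Prop. 5 (157) p.42).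
-/

set_option autoImplicit false

noncomputable section

open scoped Topology Matrix.Norms.L2Operator
open Filter NormedSpace

namespace Summit.QuantumFields.YangMills.Theorems.Prop7AvgHessGaugePointwiseIdentity

open Literature.MathematicalPhysics.QuantumFieldTheory.Balaban1983to89
open Literature.MathematicalPhysics.QuantumFieldTheory.Balaban1983to89.T3ContinuumYM3Torus
open MatrixLog (mlog exp_mlog)
open B10Eq27TorusAxialLog (holT transl gaugeActT)
open B7Prop1Explicit (expUnit disp)
open B7TransferAnalyticMean (meanCLM)
open T4Continuum BlockAveraging
open T3PrintedRegularMinimiser (RegPr)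
open T3PrintedRegularOrbits (sites_eq)
open T3LevelShift (siteShift bondShift)
open T3SectALandauChart (bgUnits eta eta_pos)
open B15DeterminingSets (embIter)
open Summit.QuantumFields.YangMills.Theorems.Prop8Chart (emlIterU)
open Summit.QuantumFields.YangMills.Theorems.Prop7SymAvgTwSym (frameAccU frameAccU_self frameTwS frameTwS_def dbarTwS dbarTwS_zero logChartTwS logChartTwS_apply logChartTwS_zero QTwS QTwS_def)
open Summit.QuantumFields.YangMills.Theorems.Prop7SymAvgGL (expUnit_zero_mul_bgUnits)
open Summit.QuantumFields.YangMills.Theorems.Prop7SectET3DeltaOne (avgHess avgHess_def)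
open Summit.QuantumFields.YangMills.Theorems.Prop7CmapTwSymInputs (analyticOnNhd_logChartTwS)
open Summit.QuantumFields.YangMills.Theorems.Prop7TwistedSliceTangent (hasFDerivAt_mlog_injective norm_dbarTwS_sub_one_lt_one_of_regPr)
open Summit.QuantumFields.YangMills.Theorems.Prop7ChartGaugeCovarianceDeriv (fderiv_logChartTwS_gaugeVelocity_apply)
open Summit.QuantumFields.YangMills.Theorems.Prop7MlogSecondDerivative (hasDerivAt_fderiv_mlog_comp_apply)
open Summit.QuantumFields.YangMills.Theorems.Prop7ChartGaugeCurveAt (hasDerivAt_chartCurveAt_real chartCurveAt_zero expUnit_chartCurveAt_eventually_real gaugeVelocityAt_zero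
  hasDerivAt_gaugeVelocityAt_smul gaugeFamily_zero hasDerivAt_gaugeFamily)
open Summit.QuantumFields.YangMills.Theorems.Prop7FrameResponseAtChartPoint (lt_log_two_of_le_e_eta hasDerivAt_frameAccU_gaugeCopyAt fderiv_frameTwS_zero_gaugeDir kappaAt_zero
  hasDerivAt_kappaAt_smul)

/-! ## §1 x-form readings of F3 at a top-level site, and the closing ring identity -/

section SiteForm

variable (F : T3Family) {n K : ℕ} (h : n ≤ K)

include h in
/-- **FR₁ AT A CHART POINT, TOP-LEVEL SITE FORM**: F3 ★★`hasDerivAt_frameAccU_gaugeCopyAt` at `y := (siteShift)⁻¹ x`, frames read as `w_x(A) = frameAccU (K−n) U₀♭ (e^{A}U₀♭) x` — the letter `hFr` of ✓p769222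
verbatim at `A = A₀`. [cite: Balaban1985Averaging, (11) p.19, (97) p.32, Prop. 4 p.38] -/
theorem hasDerivAt_frameAccU_gaugeCopyAt_site {ε₀ e : ℝ} (hε₀ : 0 < ε₀) (he : 0 < e) (hWe : 10 ^ 9 * (F.L : ℝ) ^ 2 * e ≤ 1) (hWε : 10 ^ 12 * (F.L : ℝ) ^ 3 * ε₀ ≤ 1)
    (U₀ : GaugeField (F.P K) 0 (Matrix.specialUnitaryGroup (Fin 2) ℂ)) (hreg : RegPr F n K ε₀ U₀) (N : Site (F.P K) 0 → Matrix (Fin 2) (Fin 2) ℂ)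
    {A₀ : PBond (F.P K) 0 → Matrix (Fin 2) (Fin 2) ℂ} (hA₀ : ∀ b, ‖A₀ b‖ ≤ e * eta F n K) (x : Site (F.P K) (K - n)) :
    HasDerivAt (fun t : ℝ => ((frameAccU (K - n) (bgUnits F K U₀) (gaugeActT (fun z : Site (F.P K) 0 => expUnit ((t : ℂ) • N z)) (fun b => expUnit (A₀ b) * bgUnits F K U₀ b)) x : (Matrix (Fin 2) (Fin 2) ℂ)ˣ) : Matrix (Fin 2) (Fin 2) ℂ))
      (fderiv ℂ (fun A : PBond (F.P K) 0 → Matrix (Fin 2) (Fin 2) ℂ => ((frameAccU (K - n) (bgUnits F K U₀) (fun b => expUnit (A b) * bgUnits F K U₀ b) x : (Matrix (Fin 2) (Fin 2) ℂ)ˣ) : Matrix (Fin 2) (Fin 2) ℂ)) A₀ (fun b : PBond (F.P K) 0 => fderiv ℂ (mlog : Matrix (Fin 2) (Fin 2) ℂ → Matrix (Fin 2) (Fin 2) ℂ) (exp ((A₀) b)) (N b.src * exp ((A₀) b) - exp ((A₀) b) * (((bgUnits F K U₀ b : (Matrix (Fin 2) (Fin 2) ℂ)ˣ) : Matrix (Fin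 2) (Fin 2) ℂ) * N b.tgt * (((bgUnits F K U₀ b)⁻¹ : (Matrix (Fin 2) (Fin 2) ℂ)ˣ) : Matrix (Fin 2) (Fin 2) ℂ))))) 0 := by
  have h1 := hasDerivAt_frameAccU_gaugeCopyAt F h hε₀ he hWe hWε U₀ hreg N hA₀ ((siteShift (sites_eq F n K h)).symm x)
  simp only [frameTwS_def, Equiv.apply_symm_apply] at h1
  exact h1

include h in
/-- **`Dw_x(0)[D_{U₀}N] = N(x̂x) − ns(x)`**, top-level site form of F3 ★`fderiv_frameTwS_zero_gaugeDir`. [cite: Balaban1985Averaging, (97) p.32; Balaban1985BackgroundPropagators, (3.19) p.393] -/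
theorem fderiv_frameAccU_zero_gaugeDir_site {ε₀ : ℝ} (hε₀ : 0 < ε₀) (hWε : 10 ^ 12 * (F.L : ℝ) ^ 3 * ε₀ ≤ 1)
    (U₀ : GaugeField (F.P K) 0 (Matrix.specialUnitaryGroup (Fin 2) ℂ)) (hreg : RegPr F n K ε₀ U₀) (N : Site (F.P K) 0 → Matrix (Fin 2) (Fin 2) ℂ)
    (ns : (j : ℕ) → Site (F.P K) j → Matrix (Fin 2) (Fin 2) ℂ) (h0 : ns 0 = N)
    (hsucc : ∀ (j : ℕ) (z : Site (F.P K) (j + 1)), ns (j + 1) z = ns j (emb z) - meanCLM (Idx (F.P K)) (Matrix (Fin 2) (Fin 2) ℂ) fun i : Idx (F.P K) =>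
        ns j (emb z) - ((holT (emlIterU j (bgUnits F K U₀)) (emb z) (stairWord i.2.1 (off i.1)) : (Matrix (Fin 2) (Fin 2) ℂ)ˣ) : Matrix (Fin 2) (Fin 2) ℂ) *
          ns j (transl (emb z) (disp (stairWord i.2.1 (off i.1)))) * (((holT (emlIterU j (bgUnits F K U₀)) (emb z) (stairWord i.2.1 (off i.1)))⁻¹ : (Matrix (Fin 2) (Fin 2) ℂ)ˣ) : Matrix (Fin 2) (Fin 2) ℂ))
    (x : Site (F.P K) (K - n)) :
    fderiv ℂ (fun A : PBond (F.P K) 0 → Matrix (Fin 2) (Fin 2) ℂ => ((frameAccU (K - n) (bgUnits F K U₀) (fun b => expUnit (A b) * bgUnits F K U₀ b) x : (Matrix (Fin 2) (Fin 2) ℂ)ˣ) : Matrix (Fin 2) (Fin 2) ℂ)) 0 (fun b : PBond (F.P K) 0 => N b.src - ((bgUnits F K U₀ b : (Matrix (Fin 2) (Fin 2) ℂ)ˣ) : Matrix (Fin 2) (Fin 2) ℂ) * N b.tgt * (((bgUnits F K U₀ b)⁻¹ : (Matrix (Fin 2) (Fin 2) ℂ)ˣ) : Matrix (Fin 2) (Fin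 2) ℂ)) = N (embIter (K - n) x) - ns (K - n) x := by
  have h1 := fderiv_frameTwS_zero_gaugeDir F h hε₀ hWε U₀ hreg N ns h0 hsucc ((siteShift (sites_eq F n K h)).symm x)
  simp only [frameTwS_def, Equiv.apply_symm_apply] at h1
  exact h1

include h in
/-- **`κ(0) = ns(x)`**, top-level site form of F3 `kappaAt_zero`. [cite: Balaban1985BackgroundPropagators, (3.19) p.393] -/
theorem kappaAt_zero_site {ε₀ : ℝ} (hε₀ : 0 < ε₀) (hWε : 10 ^ 12 * (F.L : ℝ) ^ 3 * ε₀ ≤ 1)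
    (U₀ : GaugeField (F.P K) 0 (Matrix.specialUnitaryGroup (Fin 2) ℂ)) (hreg : RegPr F n K ε₀ U₀) (Y : PBond (F.P K) 0 → Matrix (Fin 2) (Fin 2) ℂ) (N : Site (F.P K) 0 → Matrix (Fin 2) (Fin 2) ℂ)
    (ns : (j : ℕ) → Site (F.P K) j → Matrix (Fin 2) (Fin 2) ℂ) (h0 : ns 0 = N)
    (hsucc : ∀ (j : ℕ) (z : Site (F.P K) (j + 1)), ns (j + 1) z = ns j (emb z) - meanCLM (Idx (F.P K)) (Matrix (Fin 2) (Fin 2) ℂ) fun i : Idx (F.P K) =>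
        ns j (emb z) - ((holT (emlIterU j (bgUnits F K U₀)) (emb z) (stairWord i.2.1 (off i.1)) : (Matrix (Fin 2) (Fin 2) ℂ)ˣ) : Matrix (Fin 2) (Fin 2) ℂ) *
          ns j (transl (emb z) (disp (stairWord i.2.1 (off i.1)))) * (((holT (emlIterU j (bgUnits F K U₀)) (emb z) (stairWord i.2.1 (off i.1)))⁻¹ : (Matrix (Fin 2) (Fin 2) ℂ)ˣ) : Matrix (Fin 2) (Fin 2) ℂ))
    (x : Site (F.P K) (K - n)) :
    ((((frameAccU (K - n) (bgUnits F K U₀) (fun b => expUnit (((0 : ℂ) • Y) b) * bgUnits F K U₀ b) x)⁻¹ : (Matrix (Fin 2) (Fin 2) ℂ)ˣ) : Matrix (Fin 2) (Fin 2) ℂ) * (N (embIter (K - n) x) - fderiv ℂ (fun A : PBond (F.P K) 0 → Matrix (Fin 2) (Fin 2) ℂ => ((frameAccU (K - n) (bgUnits F K U₀) (fun b => expUnit (A b) * bgUnits F K U₀ b) x : (Matrix (Fin 2) (Fin 2) ℂ)ˣ) : Matrix (Fin 2) (Fin 2) ℂ)) ((0 : ℂ) • Y) (fun b : PBond (F.P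 K) 0 => fderiv ℂ (mlog : Matrix (Fin 2) (Fin 2) ℂ → Matrix (Fin 2) (Fin 2) ℂ) (exp (((0 : ℂ) • Y) b)) (N b.src * exp (((0 : ℂ) • Y) b) - exp (((0 : ℂ) • Y) b) * (((bgUnits F K U₀ b : (Matrix (Fin 2) (Fin 2) ℂ)ˣ) : Matrix (Fin 2) (Fin 2) ℂ) * N b.tgt * (((bgUnits F K U₀ b)⁻¹ : (Matrix (Fin 2) (Fin 2) ℂ)ˣ) : Matrix (Fin 2) (Fin 2) ℂ)))) * (((frameAccU (K - n) (bgUnits F K U₀) (fun b => expUnit (((0 : ℂ) • Y) b) * bgUnits F K U₀ b) x)⁻¹ : (Matrix (Fin 2) (Fin 2) ℂ)ˣ) : Matrix (Fin 2) (Fin 2) ℂ)) * ((frameAccU (K - n) (bgUnits F K U₀) (fun b => expUnit (((0 : ℂ) • Y) b) * bgUnits F K U₀ b) x : (Matrix (Fin 2) (Fin 2) ℂ)ˣ) : Matrix (Fin 2) (Fin 2) ℂ)) = ns (K - n) x := by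
  have h1 := kappaAt_zero F h hε₀ hWε U₀ hreg Y N ns h0 hsucc ((siteShift (sites_eq F n K h)).symm x)
  simp only [frameTwS_def, Equiv.apply_symm_apply] at h1
  exact h1

include h in
/-- ★★★ **`κ′(0) = κY(x)`**, top-level site form of F3 ★★★`hasDerivAt_kappaAt_smul`: the chart×gauge mixed derivative of the frame-corrected coarse gauge map at `x`.
[cite: Balaban1985Averaging, (97) p.32; Balaban1985BackgroundPropagators, (3.19) p.393, (3.114)–(3.115) p.418] -/
theorem hasDerivAt_kappaAt_smul_site {ε₀ : ℝ} (hε₀ : 0 < ε₀) (hWε : 10 ^ 12 * (F.L : ℝ) ^ 3 * ε₀ ≤ 1)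
    (U₀ : GaugeField (F.P K) 0 (Matrix.specialUnitaryGroup (Fin 2) ℂ)) (hreg : RegPr F n K ε₀ U₀) (Y : PBond (F.P K) 0 → Matrix (Fin 2) (Fin 2) ℂ) (N : Site (F.P K) 0 → Matrix (Fin 2) (Fin 2) ℂ)
    (ns : (j : ℕ) → Site (F.P K) j → Matrix (Fin 2) (Fin 2) ℂ) (h0 : ns 0 = N)
    (hsucc : ∀ (j : ℕ) (z : Site (F.P K) (j + 1)), ns (j + 1) z = ns j (emb z) - meanCLM (Idx (F.P K)) (Matrix (Fin 2) (Fin 2) ℂ) fun i : Idx (F.P K) =>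
        ns j (emb z) - ((holT (emlIterU j (bgUnits F K U₀)) (emb z) (stairWord i.2.1 (off i.1)) : (Matrix (Fin 2) (Fin 2) ℂ)ˣ) : Matrix (Fin 2) (Fin 2) ℂ) *
          ns j (transl (emb z) (disp (stairWord i.2.1 (off i.1)))) * (((holT (emlIterU j (bgUnits F K U₀)) (emb z) (stairWord i.2.1 (off i.1)))⁻¹ : (Matrix (Fin 2) (Fin 2) ℂ)ˣ) : Matrix (Fin 2) (Fin 2) ℂ))
    (x : Site (F.P K) (K - n)) :
    HasDerivAt (fun s : ℂ => ((((frameAccU (K - n) (bgUnits F K U₀) (fun b => expUnit ((s • Y) b) * bgUnits F K U₀ b) x)⁻¹ : (Matrix (Fin 2) (Fin 2) ℂ)ˣ) : Matrix (Fin 2) (Fin 2) ℂ) * (N (embIter (K - n) x) - fderiv ℂ (fun A : PBond (F.P K) 0 → Matrix (Fin 2) (Fin 2) ℂ => ((frameAccU (K - n) (bgUnits F K U₀) (fun b => expUnit (A b) * bgUnits F K U₀ b) x : (Matrix (Fin 2) (Fin 2) ℂ)ˣ) : Matrix (Fin 2) (Fin 2) ℂ)) (s • Y) (fun b : PBond (F.P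 K) 0 => fderiv ℂ (mlog : Matrix (Fin 2) (Fin 2) ℂ → Matrix (Fin 2) (Fin 2) ℂ) (exp ((s • Y) b)) (N b.src * exp ((s • Y) b) - exp ((s • Y) b) * (((bgUnits F K U₀ b : (Matrix (Fin 2) (Fin 2) ℂ)ˣ) : Matrix (Fin 2) (Fin 2) ℂ) * N b.tgt * (((bgUnits F K U₀ b)⁻¹ : (Matrix (Fin 2) (Fin 2) ℂ)ˣ) : Matrix (Fin 2) (Fin 2) ℂ)))) * (((frameAccU (K - n) (bgUnits F K U₀) (fun b => expUnit ((s • Y) b) * bgUnits F K U₀ b) x)⁻¹ : (Matrix (Fin 2) (Fin 2) ℂ)ˣ) : Matrix (Fin 2) (Fin 2) ℂ)) * ((frameAccU (K - n) (bgUnits F K U₀) (fun b => expUnit ((s • Y) b) * bgUnits F K U₀ b) x : (Matrix (Fin 2) (Fin 2) ℂ)ˣ) : Matrix (Fin 2) (Fin 2) ℂ)))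
      ((ns (K - n) x * fderiv ℂ (fun A : PBond (F.P K) 0 → Matrix (Fin 2) (Fin 2) ℂ => ((frameAccU (K - n) (bgUnits F K U₀) (fun b => expUnit (A b) * bgUnits F K U₀ b) x : (Matrix (Fin 2) (Fin 2) ℂ)ˣ) : Matrix (Fin 2) (Fin 2) ℂ)) 0 Y - fderiv ℂ (fun A : PBond (F.P K) 0 → Matrix (Fin 2) (Fin 2) ℂ => ((frameAccU (K - n) (bgUnits F K U₀) (fun b => expUnit (A b) * bgUnits F K U₀ b) x : (Matrix (Fin 2) (Fin 2) ℂ)ˣ) : Matrix (Fin 2) (Fin 2) ℂ)) 0 Y * ns (K - n) x) + (N (embIter (K - n) x) - ns (K - n) x) * fderiv ℂ (fun A : PBond (F.P K) 0 → Matrix (Fin 2) (Fin 2) ℂ => ((frameAccU (K - n) (bgUnits F K U₀) (fun b => expUnit (A b) * bgUnits F K U₀ b) x : (Matrix (Fin 2) (Fin 2) ℂ)ˣ) : Matrix (Fin 2) (Fin 2) ℂ)) 0 Y - (fderiv ℂ (fderiv ℂ (fun A : PBond (F.P K) 0 → Matrix (Fin 2) (Fin 2) ℂ => ((frameAccU (K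 - n) (bgUnits F K U₀) (fun b => expUnit (A b) * bgUnits F K U₀ b) x : (Matrix (Fin 2) (Fin 2) ℂ)ˣ) : Matrix (Fin 2) (Fin 2) ℂ))) 0 Y (fun b : PBond (F.P K) 0 => N b.src - ((bgUnits F K U₀ b : (Matrix (Fin 2) (Fin 2) ℂ)ˣ) : Matrix (Fin 2) (Fin 2) ℂ) * N b.tgt * (((bgUnits F K U₀ b)⁻¹ : (Matrix (Fin 2) (Fin 2) ℂ)ˣ) : Matrix (Fin 2) (Fin 2) ℂ)) + fderiv ℂ (fun A : PBond (F.P K) 0 → Matrix (Fin 2) (Fin 2) ℂ => ((frameAccU (K - n) (bgUnits F K U₀) (fun b => expUnit (A b) * bgUnits F K U₀ b) x : (Matrix (Fin 2) (Fin 2) ℂ)ˣ) : Matrix (Fin 2) (Fin 2) ℂ)) 0 (fun b : PBond (F.P K) 0 => (2 : ℂ)⁻¹ • ((N b.src + ((bgUnits F K U₀ b : (Matrix (Fin 2) (Fin 2) ℂ)ˣ) : Matrix (Fin 2) (Fin 2) ℂ) * N b.tgt * (((bgUnits F K U₀ b)⁻¹ : (Matrix (Fin 2) (Fin 2) ℂ)ˣ)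 : Matrix (Fin 2) (Fin 2) ℂ)) * Y b - Y b * (N b.src + ((bgUnits F K U₀ b : (Matrix (Fin 2) (Fin 2) ℂ)ˣ) : Matrix (Fin 2) (Fin 2) ℂ) * N b.tgt * (((bgUnits F K U₀ b)⁻¹ : (Matrix (Fin 2) (Fin 2) ℂ)ˣ) : Matrix (Fin 2) (Fin 2) ℂ)))))) 0 := by
  have h1 := hasDerivAt_kappaAt_smul F h hε₀ hWε U₀ hreg Y N ns h0 hsucc ((siteShift (sites_eq F n K h)).symm x)
  simp only [frameTwS_def, Equiv.apply_symm_apply] at h1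
  exact h1

end SiteForm

section Algebra

variable {𝔸 : Type*} [Ring 𝔸] [Module ℂ 𝔸]

/-- **THE CLOSING RING IDENTITY OF (2)**: from `a + ½q = −½(σZ₀ + Z₀σ) + Z′` with `Z₀ = nₛ − E nₜ Eᵢ`, `Z′ = κₛ + nₛσ − (σ E nₜ Eᵢ + E κₜ Eᵢ)` (the two sides of the differentiated first-order law),
`a = −½q + ½[(nₛ + E nₜ Eᵢ), σ] + (κₛ − E κₜ Eᵢ)`. [folklore] -/
theorem solve_avgHess {a q σ ns₁ ns₂ E Ei ks kt : 𝔸}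
    (hq : a + (2 : ℂ)⁻¹ • q = -((2 : ℂ)⁻¹ • (σ * (ns₁ * 1 - 1 * (E * ns₂ * Ei)) + (ns₁ * 1 - 1 * (E * ns₂ * Ei)) * σ))
      + (ks * 1 + ns₁ * σ - (σ * (E * ns₂ * Ei) + 1 * (E * kt * Ei)))) :
    a = -((2 : ℂ)⁻¹ • q) + (2 : ℂ)⁻¹ • ((ns₁ + E * ns₂ * Ei) * σ - σ * (ns₁ + E * ns₂ * Ei)) + (ks - E * kt * Ei) := by
  have ha : a = -((2 : ℂ)⁻¹ • (σ * (ns₁ * 1 - 1 * (E * ns₂ * Ei)) + (ns₁ * 1 - 1 * (E * ns₂ * Ei)) * σ))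
      + (ks * 1 + ns₁ * σ - (σ * (E * ns₂ * Ei) + 1 * (E * kt * Ei))) - (2 : ℂ)⁻¹ • q := eq_sub_of_add_eq hq
  rw [ha]
  have key : ∀ u w : 𝔸, (2 : ℂ) • u = (2 : ℂ) • w → u = w := fun u w huw => by
    calc u = (2 : ℂ)⁻¹ • ((2 : ℂ) • u) := (inv_smul_smul₀ two_ne_zero u).symm
      _ = (2 : ℂ)⁻¹ • ((2 : ℂ) • w) := by rw [huw]
      _ = w := inv_smul_smul₀ two_ne_zero w
  apply key
  simp only [smul_add, smul_sub, smul_neg, smul_smul, mul_inv_cancel₀ (two_ne_zero : (2 : ℂ) ≠ 0), one_smul]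
  simp only [two_smul]
  noncomm_ring

end Algebra

/-! ## §2 The identity (2) -/

section Main

variable (F : T3Family) {n K : ℕ} (h : n ≤ K)

/-- ★★★ **THE POINTWISE SECOND-ORDER GAUGE-COVARIANCE IDENTITY (2)** at a printed-regular background (`RegPr F n K ε₀ U₀`, `10¹²L³ε₀ ≤ 1`): for every chart direction `Y`, fine gauge parameter
`N`, averaging sequence `ns` of `N` against the background tower and comparison bond `c` (`ĉ = bondShift c`, `Ū₀(ĉ) = emlIterU (K−n) U₀♭ ĉ`, `σ_c = QTwS U₀ Y c`),
`avgHess U₀ Y (b ↦ N(b₋) − U₀(b)N(b₊)U₀(b)⁻¹) c = −2⁻¹•QTwS U₀ (b ↦ (N(b₋) + U₀N(b₊)U₀⁻¹)·Y(b) − Y(b)·(N(b₋) + U₀N(b₊)U₀⁻¹)) c`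
`  + 2⁻¹•((ns(ĉ₋) + Ū₀ns(ĉ₊)Ū₀⁻¹)·σ_c − σ_c·(ns(ĉ₋) + Ū₀ns(ĉ₊)Ū₀⁻¹)) + (κY(ĉ₋) − Ū₀·κY(ĉ₊)·Ū₀⁻¹)`,
`κY(x) = (ns(x)·v′(x) − v′(x)·ns(x)) + (N(x̂x) − ns(x))·v′(x) − (D²w_x(0)[Y, D_{U₀}N] + Dw_x(0)[2⁻¹•comm])`, `v′(x) = Dw_x(0)[Y]`, `w_x(A) = frameAccU (K−n) U₀♭ (e^{A}U₀♭) x` — ✓p774022's `h2`.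
[cite: Balaban1985BackgroundPropagators, (3.114)–(3.115) p.418, (3.13)–(3.16) and (3.19) p.393; Balaban1985Averaging, (11) p.19, (21) p.21, (97) p.32, Prop. 5 (157) p.42] -/
theorem avgHess_gaugeDir_apply {ε₀ : ℝ} (hε₀ : 0 < ε₀) (hWε : 10 ^ 12 * (F.L : ℝ) ^ 3 * ε₀ ≤ 1)
    (U₀ : GaugeField (F.P K) 0 (Matrix.specialUnitaryGroup (Fin 2) ℂ)) (hreg : RegPr F n K ε₀ U₀) (Y : PBond (F.P K) 0 → Matrix (Fin 2) (Fin 2) ℂ) (N : Site (F.P K) 0 → Matrix (Fin 2) (Fin 2) ℂ)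
    (ns : (j : ℕ) → Site (F.P K) j → Matrix (Fin 2) (Fin 2) ℂ) (h0 : ns 0 = N)
    (hsucc : ∀ (j : ℕ) (z : Site (F.P K) (j + 1)), ns (j + 1) z = ns j (emb z) - meanCLM (Idx (F.P K)) (Matrix (Fin 2) (Fin 2) ℂ) fun i : Idx (F.P K) =>
        ns j (emb z) - ((holT (emlIterU j (bgUnits F K U₀)) (emb z) (stairWord i.2.1 (off i.1)) : (Matrix (Fin 2) (Fin 2) ℂ)ˣ) : Matrix (Fin 2) (Fin 2) ℂ) *
          ns j (transl (emb z) (disp (stairWord i.2.1 (off i.1)))) * (((holT (emlIterU j (bgUnits F K U₀)) (emb z) (stairWord i.2.1 (off i.1)))⁻¹ : (Matrix (Fin 2) (Fin 2) ℂ)ˣ) : Matrix (Fin 2) (Fin 2) ℂ))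
    (c : PBond (F.P n) 0) :
    avgHess F n K h U₀ Y (fun b : PBond (F.P K) 0 => N b.src - ((bgUnits F K U₀ b : (Matrix (Fin 2) (Fin 2) ℂ)ˣ) : Matrix (Fin 2) (Fin 2) ℂ) * N b.tgt * (((bgUnits F K U₀ b)⁻¹ : (Matrix (Fin 2) (Fin 2) ℂ)ˣ) : Matrix (Fin 2) (Fin 2) ℂ)) c
      = -((2 : ℂ)⁻¹ • QTwS F n K h U₀ (fun b : PBond (F.P K) 0 => (N b.src + ((bgUnits F K U₀ b : (Matrix (Fin 2) (Fin 2) ℂ)ˣ) : Matrix (Fin 2) (Fin 2) ℂ) * N b.tgt * (((bgUnits F K U₀ b)⁻¹ : (Matrix (Fin 2) (Fin 2) ℂ)ˣ) : Matrix (Fin 2) (Fin 2) ℂ)) * Y b - Y b * (N b.src + ((bgUnits F K U₀ b : (Matrix (Fin 2) (Fin 2) ℂ)ˣ) : Matrix (Fin 2) (Fin 2) ℂ) * N b.tgt * (((bgUnits F K U₀ b)⁻¹ : (Matrix (Fin 2) (Fin 2) ℂ)ˣ) : Matrix (Fin 2) (Fin 2) ℂ))) c)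
        + (2 : ℂ)⁻¹ • ((ns (K - n) (bondShift (sites_eq F n K h) c).src + ((emlIterU (K - n) (bgUnits F K U₀) (bondShift (sites_eq F n K h) c) : (Matrix (Fin 2) (Fin 2) ℂ)ˣ) : Matrix (Fin 2) (Fin 2) ℂ) * ns (K - n) (bondShift (sites_eq F n K h) c).tgt * (((emlIterU (K - n) (bgUnits F K U₀) (bondShift (sites_eq F n K h) c))⁻¹ : (Matrix (Fin 2) (Fin 2) ℂ)ˣ) : Matrix (Fin 2) (Fin 2) ℂ)) * QTwS F n K h U₀ Y c - QTwS F n K h U₀ Y c * (ns (K - n) (bondShift (sites_eq F n K h) c).src + ((emlIterU (K - n) (bgUnits F K U₀) (bondShift (sites_eq F n K h) c) : (Matrix (Fin 2) (Fin 2) ℂ)ˣ) : Matrix (Fin 2) (Fin 2) ℂ) * ns (K - n) (bondShift (sites_eq F n K h) c).tgt * (((emlIterU (K - n) (bgUnits F K U₀) (bondShift (sites_eq F n K h) c))⁻¹ : (Matrix (Fin 2) (Fin 2) ℂ)ˣ) : Matrix (Fin 2) (Fin 2) ℂ)))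
        + (((ns (K - n) (bondShift (sites_eq F n K h) c).src * fderiv ℂ (fun A : PBond (F.P K) 0 → Matrix (Fin 2) (Fin 2) ℂ => ((frameAccU (K - n) (bgUnits F K U₀) (fun b => expUnit (A b) * bgUnits F K U₀ b) (bondShift (sites_eq F n K h) c).src : (Matrix (Fin 2) (Fin 2) ℂ)ˣ) : Matrix (Fin 2) (Fin 2) ℂ)) 0 Y - fderiv ℂ (fun A : PBond (F.P K) 0 → Matrix (Fin 2) (Fin 2) ℂ => ((frameAccU (K - n) (bgUnits F K U₀) (fun b => expUnit (A b) * bgUnits F K U₀ b) (bondShift (sites_eq F n K h) c).src : (Matrix (Fin 2) (Fin 2) ℂ)ˣ) : Matrix (Fin 2) (Fin 2) ℂ)) 0 Y * ns (K - n) (bondShift (sites_eq F n K h) c).src) + (N (embIter (K - n) (bondShift (sites_eq F n K h) c).src) - ns (K - n) (bondShift (sites_eq F n K h) c).src) * fderiv ℂ (fun A : PBond (F.P K) 0 → Matrix (Fin 2) (Fin 2) ℂ => ((frameAccU (K - n) (bgUnits F K U₀) (fun b => expUnit (A b) * bgUnits F K U₀ b) (bondShift (sites_eq F n K h) c).src :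 (Matrix (Fin 2) (Fin 2) ℂ)ˣ) : Matrix (Fin 2) (Fin 2) ℂ)) 0 Y - (fderiv ℂ (fderiv ℂ (fun A : PBond (F.P K) 0 → Matrix (Fin 2) (Fin 2) ℂ => ((frameAccU (K - n) (bgUnits F K U₀) (fun b => expUnit (A b) * bgUnits F K U₀ b) (bondShift (sites_eq F n K h) c).src : (Matrix (Fin 2) (Fin 2) ℂ)ˣ) : Matrix (Fin 2) (Fin 2) ℂ))) 0 Y (fun b : PBond (F.P K) 0 => N b.src - ((bgUnits F K U₀ b : (Matrix (Fin 2) (Fin 2) ℂ)ˣ) : Matrix (Fin 2) (Fin 2) ℂ) * N b.tgt * (((bgUnits F K U₀ b)⁻¹ : (Matrix (Fin 2) (Fin 2) ℂ)ˣ) : Matrix (Fin 2) (Fin 2) ℂ)) + fderiv ℂ (fun A : PBond (F.P K) 0 → Matrix (Fin 2) (Fin 2) ℂ => ((frameAccU (K - n) (bgUnits F K U₀) (fun b => expUnit (A b) * bgUnits F K U₀ b) (bondShift (sites_eq F n K h) c).src : (Matrix (Fin 2) (Fin 2) ℂ)ˣ) : Matrix (Fin 2) (Fin 2) ℂ)) 0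 (fun b : PBond (F.P K) 0 => (2 : ℂ)⁻¹ • ((N b.src + ((bgUnits F K U₀ b : (Matrix (Fin 2) (Fin 2) ℂ)ˣ) : Matrix (Fin 2) (Fin 2) ℂ) * N b.tgt * (((bgUnits F K U₀ b)⁻¹ : (Matrix (Fin 2) (Fin 2) ℂ)ˣ) : Matrix (Fin 2) (Fin 2) ℂ)) * Y b - Y b * (N b.src + ((bgUnits F K U₀ b : (Matrix (Fin 2) (Fin 2) ℂ)ˣ) : Matrix (Fin 2) (Fin 2) ℂ) * N b.tgt * (((bgUnits F K U₀ b)⁻¹ : (Matrix (Fin 2) (Fin 2) ℂ)ˣ) : Matrix (Fin 2) (Fin 2) ℂ)))))) - ((emlIterU (K - n) (bgUnits F K U₀) (bondShift (sites_eq F n K h) c) : (Matrix (Fin 2) (Fin 2) ℂ)ˣ) : Matrix (Fin 2) (Fin 2) ℂ) * ((ns (K - n) (bondShift (sites_eq F n K h) c).tgt * fderiv ℂ (fun A : PBond (F.P K) 0 → Matrix (Fin 2) (Fin 2) ℂ => ((frameAccU (K - n) (bgUnits F K U₀) (fun b => expUnit (A b) * bgUnits F K U₀ b) (bondShift (sites_eq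 F n K h) c).tgt : (Matrix (Fin 2) (Fin 2) ℂ)ˣ) : Matrix (Fin 2) (Fin 2) ℂ)) 0 Y - fderiv ℂ (fun A : PBond (F.P K) 0 → Matrix (Fin 2) (Fin 2) ℂ => ((frameAccU (K - n) (bgUnits F K U₀) (fun b => expUnit (A b) * bgUnits F K U₀ b) (bondShift (sites_eq F n K h) c).tgt : (Matrix (Fin 2) (Fin 2) ℂ)ˣ) : Matrix (Fin 2) (Fin 2) ℂ)) 0 Y * ns (K - n) (bondShift (sites_eq F n K h) c).tgt) + (N (embIter (K - n) (bondShift (sites_eq F n K h) c).tgt) - ns (K - n) (bondShift (sites_eq F n K h) c).tgt) * fderiv ℂ (fun A : PBond (F.P K) 0 → Matrix (Fin 2) (Fin 2) ℂ => ((frameAccU (K - n) (bgUnits F K U₀) (fun b => expUnit (A b) * bgUnits F K U₀ b) (bondShift (sites_eq F n K h) c).tgt : (Matrix (Fin 2) (Fin 2) ℂ)ˣ) : Matrix (Fin 2) (Fin 2) ℂ)) 0 Y - (fderiv ℂ (fderiv ℂ (fun A : PBond (F.P K) 0 → Matrix (Fin 2) (Fin 2) ℂ => ((frameAccU (K - n)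 (bgUnits F K U₀) (fun b => expUnit (A b) * bgUnits F K U₀ b) (bondShift (sites_eq F n K h) c).tgt : (Matrix (Fin 2) (Fin 2) ℂ)ˣ) : Matrix (Fin 2) (Fin 2) ℂ))) 0 Y (fun b : PBond (F.P K) 0 => N b.src - ((bgUnits F K U₀ b : (Matrix (Fin 2) (Fin 2) ℂ)ˣ) : Matrix (Fin 2) (Fin 2) ℂ) * N b.tgt * (((bgUnits F K U₀ b)⁻¹ : (Matrix (Fin 2) (Fin 2) ℂ)ˣ) : Matrix (Fin 2) (Fin 2) ℂ)) + fderiv ℂ (fun A : PBond (F.P K) 0 → Matrix (Fin 2) (Fin 2) ℂ => ((frameAccU (K - n) (bgUnits F K U₀) (fun b => expUnit (A b) * bgUnits F K U₀ b) (bondShift (sites_eq F n K h) c).tgt : (Matrix (Fin 2) (Fin 2) ℂ)ˣ) : Matrix (Fin 2) (Fin 2) ℂ)) 0 (fun b : PBond (F.P K) 0 => (2 : ℂ)⁻¹ • ((N b.src + ((bgUnits F K U₀ b : (Matrix (Fin 2) (Fin 2) ℂ)ˣ) : Matrix (Fin 2) (Fin 2) ℂ) * N b.tgt * (((bgUnits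 F K U₀ b)⁻¹ : (Matrix (Fin 2) (Fin 2) ℂ)ˣ) : Matrix (Fin 2) (Fin 2) ℂ)) * Y b - Y b * (N b.src + ((bgUnits F K U₀ b : (Matrix (Fin 2) (Fin 2) ℂ)ˣ) : Matrix (Fin 2) (Fin 2) ℂ) * N b.tgt * (((bgUnits F K U₀ b)⁻¹ : (Matrix (Fin 2) (Fin 2) ℂ)ˣ) : Matrix (Fin 2) (Fin 2) ℂ)))))) * (((emlIterU (K - n) (bgUnits F K U₀) (bondShift (sites_eq F n K h) c))⁻¹ : (Matrix (Fin 2) (Fin 2) ℂ)ˣ) : Matrix (Fin 2) (Fin 2) ℂ)) := by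
  -- (0) the L-only chart radius `e = (10⁹L²)⁻¹` and the good set of parameters
  have hL0 : (0 : ℝ) < F.L := by exact_mod_cast (lt_trans zero_lt_one F.hL.2)
  set e : ℝ := (10 ^ 9 * (F.L : ℝ) ^ 2)⁻¹ with he
  have hpos : (0 : ℝ) < 10 ^ 9 * (F.L : ℝ) ^ 2 := by positivity
  have he0 : 0 < e := by rw [he]; exact inv_pos.2 hpos
  have hWe : 10 ^ 9 * (F.L : ℝ) ^ 2 * e ≤ 1 := by rw [he, mul_inv_cancel₀ hpos.ne']
  have hr : 0 < e * eta F n K := mul_pos he0 (eta_pos F n K)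
  have hSan := analyticOnNhd_logChartTwS F h hε₀ he0 hWe hWε U₀ hreg
  have h0mem : (0 : PBond (F.P K) 0 → Matrix (Fin 2) (Fin 2) ℂ) ∈ Metric.ball (0 : PBond (F.P K) 0 → Matrix (Fin 2) (Fin 2) ℂ) (e * eta F n K) := Metric.mem_ball_self hr
  have hG : ∀ᶠ s : ℂ in 𝓝 0, ‖s • Y‖ < e * eta F n K := by
    have hc : Continuous fun s : ℂ => s • Y := continuous_id.smul continuous_const
    have ht : Tendsto (fun s : ℂ => s • Y) (𝓝 0) (𝓝 0) := by
      have h1 := hc.continuousAt (x := (0 : ℂ))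
      rwa [ContinuousAt, zero_smul] at h1
    filter_upwards [ht (Metric.ball_mem_nhds (0 : PBond (F.P K) 0 → Matrix (Fin 2) (Fin 2) ℂ) hr)] with s hs
    rwa [Set.mem_preimage, Metric.mem_ball, dist_zero_right] at hs
  have hs1 : HasDerivAt (fun s : ℂ => s • Y) Y 0 := by simpa using (hasDerivAt_id (0 : ℂ)).smul_const Y
  have hs0 : (0 : PBond (F.P K) 0 → Matrix (Fin 2) (Fin 2) ℂ) = (fun s : ℂ => s • Y) 0 := by simp only [zero_smul]
  -- (1) the first-order law at `A₀ = sY` for good `s` (✓p769222 with its five letters inhabited)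
  have hev : ∀ᶠ s : ℂ in 𝓝 0,
      fderiv ℂ (logChartTwS F n K h U₀) (s • Y) (fun b : PBond (F.P K) 0 => fderiv ℂ (mlog : Matrix (Fin 2) (Fin 2) ℂ → Matrix (Fin 2) (Fin 2) ℂ) (exp ((s • Y) b)) (N b.src * exp ((s • Y) b) - exp ((s • Y) b) * (((bgUnits F K U₀ b : (Matrix (Fin 2) (Fin 2) ℂ)ˣ) : Matrix (Fin 2) (Fin 2) ℂ) * N b.tgt * (((bgUnits F K U₀ b)⁻¹ : (Matrix (Fin 2) (Fin 2) ℂ)ˣ) : Matrix (Fin 2) (Fin 2) ℂ)))) c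
        = fderiv ℂ (mlog : Matrix (Fin 2) (Fin 2) ℂ → Matrix (Fin 2) (Fin 2) ℂ) ((dbarTwS F n K h U₀ (s • Y) c : (Matrix (Fin 2) (Fin 2) ℂ)ˣ) : Matrix (Fin 2) (Fin 2) ℂ)
            (((((frameAccU (K - n) (bgUnits F K U₀) (fun b => expUnit ((s • Y) b) * bgUnits F K U₀ b) (bondShift (sites_eq F n K h) c).src)⁻¹ : (Matrix (Fin 2) (Fin 2) ℂ)ˣ) : Matrix (Fin 2) (Fin 2) ℂ) * (N (embIter (K - n) (bondShift (sites_eq F n K h) c).src) - fderiv ℂ (fun A : PBond (F.P K) 0 → Matrix (Fin 2) (Fin 2) ℂ => ((frameAccU (K - n) (bgUnits F K U₀) (fun b => expUnit (A b) * bgUnits F K U₀ b) (bondShift (sites_eq F n K h) c).src : (Matrix (Fin 2) (Fin 2) ℂ)ˣ) : Matrix (Fin 2) (Fin 2) ℂ)) (s • Y) (fun b : PBond (F.P K) 0 => fderiv ℂ (mlog : Matrix (Fin 2) (Fin 2) ℂ → Matrix (Fin 2) (Fin 2) ℂ) (exp ((s • Y) b)) (N b.src * exp ((s • Y) b) - exp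 ((s • Y) b) * (((bgUnits F K U₀ b : (Matrix (Fin 2) (Fin 2) ℂ)ˣ) : Matrix (Fin 2) (Fin 2) ℂ) * N b.tgt * (((bgUnits F K U₀ b)⁻¹ : (Matrix (Fin 2) (Fin 2) ℂ)ˣ) : Matrix (Fin 2) (Fin 2) ℂ)))) * (((frameAccU (K - n) (bgUnits F K U₀) (fun b => expUnit ((s • Y) b) * bgUnits F K U₀ b) (bondShift (sites_eq F n K h) c).src)⁻¹ : (Matrix (Fin 2) (Fin 2) ℂ)ˣ) : Matrix (Fin 2) (Fin 2) ℂ)) * ((frameAccU (K - n) (bgUnits F K U₀) (fun b => expUnit ((s • Y) b) * bgUnits F K U₀ b) (bondShift (sites_eq F n K h) c).src : (Matrix (Fin 2) (Fin 2) ℂ)ˣ) : Matrix (Fin 2) (Fin 2) ℂ)) * ((dbarTwS F n K h U₀ (s • Y) c : (Matrix (Fin 2) (Fin 2) ℂ)ˣ) : Matrix (Fin 2) (Fin 2) ℂ)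
              - ((dbarTwS F n K h U₀ (s • Y) c : (Matrix (Fin 2) (Fin 2) ℂ)ˣ) : Matrix (Fin 2) (Fin 2) ℂ) * (((emlIterU (K - n) (bgUnits F K U₀) (bondShift (sites_eq F n K h) c) : (Matrix (Fin 2) (Fin 2) ℂ)ˣ) : Matrix (Fin 2) (Fin 2) ℂ) * ((((frameAccU (K - n) (bgUnits F K U₀) (fun b => expUnit ((s • Y) b) * bgUnits F K U₀ b) (bondShift (sites_eq F n K h) c).tgt)⁻¹ : (Matrix (Fin 2) (Fin 2) ℂ)ˣ) : Matrix (Fin 2) (Fin 2) ℂ) * (N (embIter (K - n) (bondShift (sites_eq F n K h) c).tgt) - fderiv ℂ (fun A : PBond (F.P K) 0 → Matrix (Fin 2) (Fin 2) ℂ => ((frameAccU (K - n) (bgUnits F K U₀) (fun b => expUnit (A b) * bgUnits F K U₀ b) (bondShift (sites_eq F n K h) c).tgt : (Matrix (Fin 2) (Fin 2) ℂ)ˣ) : Matrix (Fin 2) (Fin 2) ℂ)) (s • Y) (fun b : PBond (F.P K) 0 => fderiv ℂ (mlog : Matrix (Fin 2) (Fin 2) ℂ → Matrix (Fin 2) (Fin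 2) ℂ) (exp ((s • Y) b)) (N b.src * exp ((s • Y) b) - exp ((s • Y) b) * (((bgUnits F K U₀ b : (Matrix (Fin 2) (Fin 2) ℂ)ˣ) : Matrix (Fin 2) (Fin 2) ℂ) * N b.tgt * (((bgUnits F K U₀ b)⁻¹ : (Matrix (Fin 2) (Fin 2) ℂ)ˣ) : Matrix (Fin 2) (Fin 2) ℂ)))) * (((frameAccU (K - n) (bgUnits F K U₀) (fun b => expUnit ((s • Y) b) * bgUnits F K U₀ b) (bondShift (sites_eq F n K h) c).tgt)⁻¹ : (Matrix (Fin 2) (Fin 2) ℂ)ˣ) : Matrix (Fin 2) (Fin 2) ℂ)) * ((frameAccU (K - n) (bgUnits F K U₀) (fun b => expUnit ((s • Y) b) * bgUnits F K U₀ b) (bondShift (sites_eq F n K h) c).tgt : (Matrix (Fin 2) (Fin 2) ℂ)ˣ) : Matrix (Fin 2) (Fin 2) ℂ)) * (((emlIterU (K - n) (bgUnits F K U₀) (bondShift (sites_eq F n K h) c))⁻¹ : (Matrix (Fin 2) (Fin 2) ℂ)ˣ) : Matrix (Fin 2) (Fin 2) ℂ))) := by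
    filter_upwards [hG] with s hs
    have hsb : ∀ b, ‖(s • Y) b‖ ≤ e * eta F n K := fun b => (norm_le_pi_norm (s • Y) b).trans hs.le
    have hlog : ∀ b, ‖(s • Y) b‖ < Real.log 2 := lt_log_two_of_le_e_eta hWe hsb
    have hS : DifferentiableAt ℂ (logChartTwS F n K h U₀) (s • Y) :=
      (hSan (s • Y) (by rwa [Metric.mem_ball, dist_zero_right])).differentiableAt
    have hL : ∀ c' : PBond (F.P n) 0, HasFDerivAt (mlog : Matrix (Fin 2) (Fin 2) ℂ → Matrix (Fin 2) (Fin 2) ℂ) (fderiv ℂ (mlog : Matrix (Fin 2) (Fin 2) ℂ → Matrix (Fin 2) (Fin 2) ℂ) ((dbarTwS F n K h U₀ (s • Y) c' : (Matrix (Fin 2) (Fin 2) ℂ)ˣ) : Matrix (Fin 2) (Fin 2) ℂ)) ((dbarTwS F n K h U₀ (s • Y) c' : (Matrix (Fin 2) (Fin 2) ℂ)ˣ) : Matrix (Fin 2) (Fin 2) ℂ) :=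
      fun c' => (hasFDerivAt_mlog_injective (norm_dbarTwS_sub_one_lt_one_of_regPr F h hε₀ he0 hWe hWε U₀ hreg hs c')).1
    exact fderiv_logChartTwS_gaugeVelocity_apply (h := h) U₀ (s • Y) hS N (fun (t : ℝ) (z : Site (F.P K) 0) => expUnit ((t : ℂ) • N z))
      (gaugeFamily_zero N) (hasDerivAt_gaugeFamily N)
      (fun t : ℝ => fun b : PBond (F.P K) 0 =>
        mlog (exp ((t : ℂ) • N b.src) * (exp ((s • Y) b) * ((bgUnits F K U₀ b : (Matrix (Fin 2) (Fin 2) ℂ)ˣ) : Matrix (Fin 2) (Fin 2) ℂ)) * exp ((t : ℂ) • (-N b.tgt)) * (((bgUnits F K U₀ b)⁻¹ : (Matrix (Fin 2) (Fin 2) ℂ)ˣ) : Matrix (Fin 2) (Fin 2) ℂ)))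
      (by simp only [Complex.ofReal_zero]; exact chartCurveAt_zero U₀ N hlog) (hasDerivAt_chartCurveAt_real U₀ N hlog)
      (expUnit_chartCurveAt_eventually_real U₀ N hlog)
      (fun x => hasDerivAt_frameAccU_gaugeCopyAt_site F h hε₀ he0 hWe hWε U₀ hreg N hsb x)
      (fun c' => fderiv ℂ (mlog : Matrix (Fin 2) (Fin 2) ℂ → Matrix (Fin 2) (Fin 2) ℂ) ((dbarTwS F n K h U₀ (s • Y) c' : (Matrix (Fin 2) (Fin 2) ℂ)ˣ) : Matrix (Fin 2) (Fin 2) ℂ)) hL c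
  -- (2) the chart side: `d∕ds|₀ DS(sY)[V(sY)](c) = avgHess U₀ Y (V 0) c + DS(0)[2⁻¹•comm] c`
  have hfS : HasFDerivAt (fderiv ℂ (logChartTwS F n K h U₀)) (avgHess F n K h U₀) 0 := by
    rw [avgHess_def]; exact (hSan 0 h0mem).fderiv.differentiableAt.hasFDerivAt
  have hcS : HasDerivAt (fun s : ℂ => fderiv ℂ (logChartTwS F n K h U₀) (s • Y)) (avgHess F n K h U₀ Y) 0 := by
    have h1 := HasFDerivAt.comp_hasDerivAt_of_eq (𝕜 := ℂ) (l := fderiv ℂ (logChartTwS F n K h U₀)) (l' := avgHess F n K h U₀) (0 : ℂ) hfS hs1 hs0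
    simpa only [Function.comp_def] using h1
  have hLHS := (hasDerivAt_pi.1 (hcS.clm_apply (hasDerivAt_gaugeVelocityAt_smul U₀ N Y))) c
  -- (3) the tower side: the double bar curve `D_s`, its log-derivative, and the bracket `Z_s`
  have hQ : HasFDerivAt (logChartTwS F n K h U₀) (QTwS F n K h U₀) 0 := by
    rw [QTwS_def]; exact (hSan 0 h0mem).differentiableAt.hasFDerivAt
  have hSc : HasDerivAt (fun s : ℂ => logChartTwS F n K h U₀ (s • Y) c) (QTwS F n K h U₀ Y c) 0 := by
    have h1 := HasFDerivAt.comp_hasDerivAt_of_eq (𝕜 := ℂ) (l := logChartTwS F n K h U₀) (l' := QTwS F n K h U₀) (0 : ℂ) hQ hs1 hs0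
    have h2 := hasDerivAt_pi.1 h1 c
    simpa only [Function.comp_def] using h2
  have hexp : HasFDerivAt (exp : Matrix (Fin 2) (Fin 2) ℂ → Matrix (Fin 2) (Fin 2) ℂ) (1 : Matrix (Fin 2) (Fin 2) ℂ →L[ℂ] Matrix (Fin 2) (Fin 2) ℂ) 0 := hasFDerivAt_exp_zero
  have hS0c : (0 : Matrix (Fin 2) (Fin 2) ℂ) = (fun s : ℂ => logChartTwS F n K h U₀ (s • Y) c) 0 := by
    simp only [zero_smul, logChartTwS_zero, Pi.zero_apply]
  have hD : HasDerivAt (fun s : ℂ => ((dbarTwS F n K h U₀ (s • Y) c : (Matrix (Fin 2) (Fin 2) ℂ)ˣ) : Matrix (Fin 2) (Fin 2) ℂ)) (QTwS F n K h U₀ Y c) 0 := by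
    have h1 := HasFDerivAt.comp_hasDerivAt_of_eq (𝕜 := ℂ) (l := (exp : Matrix (Fin 2) (Fin 2) ℂ → Matrix (Fin 2) (Fin 2) ℂ)) (l' := (1 : Matrix (Fin 2) (Fin 2) ℂ →L[ℂ] Matrix (Fin 2) (Fin 2) ℂ)) (0 : ℂ) hexp hSc hS0c
    have hev2 : (fun s : ℂ => ((dbarTwS F n K h U₀ (s • Y) c : (Matrix (Fin 2) (Fin 2) ℂ)ˣ) : Matrix (Fin 2) (Fin 2) ℂ)) =ᶠ[𝓝 0] ((exp : Matrix (Fin 2) (Fin 2) ℂ → Matrix (Fin 2) (Fin 2) ℂ) ∘ fun s : ℂ => logChartTwS F n K h U₀ (s • Y) c) := by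
      filter_upwards [hG] with s hs
      rw [Function.comp_apply, logChartTwS_apply, exp_mlog (norm_dbarTwS_sub_one_lt_one_of_regPr F h hε₀ he0 hWe hWε U₀ hreg hs c)]
    have h2 := h1.congr_of_eventuallyEq hev2
    simpa only [one_apply_eq_self] using h2
  have hD0 : ((dbarTwS F n K h U₀ ((0 : ℂ) • Y) c : (Matrix (Fin 2) (Fin 2) ℂ)ˣ) : Matrix (Fin 2) (Fin 2) ℂ) = 1 := by rw [zero_smul, dbarTwS_zero, Units.val_one]
  have hκs := hasDerivAt_kappaAt_smul_site F h hε₀ hWε U₀ hreg Y N ns h0 hsucc (bondShift (sites_eq F n K h) c).src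
  have hκt := hasDerivAt_kappaAt_smul_site F h hε₀ hWε U₀ hreg Y N ns h0 hsucc (bondShift (sites_eq F n K h) c).tgt
  have hκs0 := kappaAt_zero_site F h hε₀ hWε U₀ hreg Y N ns h0 hsucc (bondShift (sites_eq F n K h) c).src
  have hκt0 := kappaAt_zero_site F h hε₀ hWε U₀ hreg Y N ns h0 hsucc (bondShift (sites_eq F n K h) c).tgt
  have hZ := (hκs.fun_mul hD).fun_sub (hD.fun_mul ((hκt.const_mul ((emlIterU (K - n) (bgUnits F K U₀) (bondShift (sites_eq F n K h) c) : (Matrix (Fin 2) (Fin 2) ℂ)ˣ) : Matrix (Fin 2) (Fin 2) ℂ)).mul_const (((emlIterU (K - n) (bgUnits F K U₀) (bondShift (sites_eq F n K h) c))⁻¹ : (Matrix (Fin 2) (Fin 2) ℂ)ˣ) : Matrix (Fin 2) (Fin 2) ℂ)))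
  have hR := hasDerivAt_fderiv_mlog_comp_apply hD0 hD hZ
  -- (4) equate the two derivatives of the same function
  have heq := (hLHS.congr_of_eventuallyEq (hev.mono fun s hs => hs.symm)).unique hR
  beta_reduce at heq
  rw [hκs0, hκt0, hD0] at heq
  rw [zero_smul, gaugeVelocityAt_zero U₀ N, ← QTwS_def, Pi.add_apply] at heq
  have hq2 : QTwS F n K h U₀ (fun b : PBond (F.P K) 0 => (2 : ℂ)⁻¹ • ((N b.src + ((bgUnits F K U₀ b : (Matrix (Fin 2) (Fin 2) ℂ)ˣ) : Matrix (Fin 2) (Fin 2) ℂ) * N b.tgt * (((bgUnits F K U₀ b)⁻¹ : (Matrix (Fin 2) (Fin 2) ℂ)ˣ) : Matrix (Fin 2) (Fin 2) ℂ)) * Y b - Y b * (N b.src + ((bgUnits F K U₀ b : (Matrix (Fin 2) (Fin 2) ℂ)ˣ) : Matrix (Fin 2) (Fin 2) ℂ) * N b.tgt * (((bgUnits F K U₀ b)⁻¹ : (Matrix (Fin 2) (Fin 2) ℂ)ˣ) : Matrix (Fin 2) (Fin 2) ℂ)))) c = (2 : ℂ)⁻¹ • QTwS F n K h U₀ (fun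 b : PBond (F.P K) 0 => (N b.src + ((bgUnits F K U₀ b : (Matrix (Fin 2) (Fin 2) ℂ)ˣ) : Matrix (Fin 2) (Fin 2) ℂ) * N b.tgt * (((bgUnits F K U₀ b)⁻¹ : (Matrix (Fin 2) (Fin 2) ℂ)ˣ) : Matrix (Fin 2) (Fin 2) ℂ)) * Y b - Y b * (N b.src + ((bgUnits F K U₀ b : (Matrix (Fin 2) (Fin 2) ℂ)ˣ) : Matrix (Fin 2) (Fin 2) ℂ) * N b.tgt * (((bgUnits F K U₀ b)⁻¹ : (Matrix (Fin 2) (Fin 2) ℂ)ˣ) : Matrix (Fin 2) (Fin 2) ℂ))) c := by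
    have hsm : (fun b : PBond (F.P K) 0 => (2 : ℂ)⁻¹ • ((N b.src + ((bgUnits F K U₀ b : (Matrix (Fin 2) (Fin 2) ℂ)ˣ) : Matrix (Fin 2) (Fin 2) ℂ) * N b.tgt * (((bgUnits F K U₀ b)⁻¹ : (Matrix (Fin 2) (Fin 2) ℂ)ˣ) : Matrix (Fin 2) (Fin 2) ℂ)) * Y b - Y b * (N b.src + ((bgUnits F K U₀ b : (Matrix (Fin 2) (Fin 2) ℂ)ˣ) : Matrix (Fin 2) (Fin 2) ℂ) * N b.tgt * (((bgUnits F K U₀ b)⁻¹ : (Matrix (Fin 2) (Fin 2) ℂ)ˣ) : Matrix (Fin 2) (Fin 2) ℂ)))) = (2 : ℂ)⁻¹ • (fun b : PBond (F.P K) 0 => (N b.src + ((bgUnits F K U₀ b : (Matrix (Fin 2) (Fin 2) ℂ)ˣ) : Matrix (Fin 2) (Fin 2) ℂ) * N b.tgt * (((bgUnits F K U₀ b)⁻¹ : (Matrix (Fin 2) (Fin 2) ℂ)ˣ) : Matrix (Fin 2) (Fin 2) ℂ)) * Y b - Y b * (N b.src + ((bgUnits F K U₀ b : (Matrix (Fin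 2) (Fin 2) ℂ)ˣ) : Matrix (Fin 2) (Fin 2) ℂ) * N b.tgt * (((bgUnits F K U₀ b)⁻¹ : (Matrix (Fin 2) (Fin 2) ℂ)ˣ) : Matrix (Fin 2) (Fin 2) ℂ))) := rfl
    rw [hsm, map_smul, Pi.smul_apply]
  rw [hq2] at heq
  exact solve_avgHess (a := avgHess F n K h U₀ Y (fun b : PBond (F.P K) 0 => N b.src - ((bgUnits F K U₀ b : (Matrix (Fin 2) (Fin 2) ℂ)ˣ) : Matrix (Fin 2) (Fin 2) ℂ) * N b.tgt * (((bgUnits F K U₀ b)⁻¹ : (Matrix (Fin 2) (Fin 2) ℂ)ˣ) : Matrix (Fin 2) (Fin 2) ℂ)) c) (q := QTwS F n K h U₀ (fun b : PBond (F.P K) 0 => (N b.src + ((bgUnits F K U₀ b : (Matrix (Fin 2) (Fin 2) ℂ)ˣ) : Matrix (Fin 2) (Fin 2) ℂ) * N b.tgt * (((bgUnits F K U₀ b)⁻¹ : (Matrix (Fin 2) (Fin 2) ℂ)ˣ) : Matrix (Fin 2) (Fin 2) ℂ)) * Y b - Y b * (N b.src + ((bgUnits F K U₀ b : (Matrix (Fin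 2) (Fin 2) ℂ)ˣ) : Matrix (Fin 2) (Fin 2) ℂ) * N b.tgt * (((bgUnits F K U₀ b)⁻¹ : (Matrix (Fin 2) (Fin 2) ℂ)ˣ) : Matrix (Fin 2) (Fin 2) ℂ))) c) (σ := QTwS F n K h U₀ Y c)
    (ns₁ := ns (K - n) (bondShift (sites_eq F n K h) c).src) (ns₂ := ns (K - n) (bondShift (sites_eq F n K h) c).tgt) (E := ((emlIterU (K - n) (bgUnits F K U₀) (bondShift (sites_eq F n K h) c) : (Matrix (Fin 2) (Fin 2) ℂ)ˣ) : Matrix (Fin 2) (Fin 2) ℂ)) (Ei := (((emlIterU (K - n) (bgUnits F K U₀) (bondShift (sites_eq F n K h) c))⁻¹ : (Matrix (Fin 2) (Fin 2) ℂ)ˣ) : Matrix (Fin 2) (Fin 2) ℂ)) (ks := ((ns (K - n) (bondShift (sites_eq F n K h) c).src * fderiv ℂ (fun A : PBond (F.P K) 0 → Matrix (Fin 2) (Fin 2) ℂ => ((frameAccU (K - n) (bgUnits F K U₀) (fun b => expUnit (A b) * bgUnits F K U₀ b) (bondShift (sites_eq F n K h) c).src : (Matrix (Fin 2) (Fin 2)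 ℂ)ˣ) : Matrix (Fin 2) (Fin 2) ℂ)) 0 Y - fderiv ℂ (fun A : PBond (F.P K) 0 → Matrix (Fin 2) (Fin 2) ℂ => ((frameAccU (K - n) (bgUnits F K U₀) (fun b => expUnit (A b) * bgUnits F K U₀ b) (bondShift (sites_eq F n K h) c).src : (Matrix (Fin 2) (Fin 2) ℂ)ˣ) : Matrix (Fin 2) (Fin 2) ℂ)) 0 Y * ns (K - n) (bondShift (sites_eq F n K h) c).src) + (N (embIter (K - n) (bondShift (sites_eq F n K h) c).src) - ns (K - n) (bondShift (sites_eq F n K h) c).src) * fderiv ℂ (fun A : PBond (F.P K) 0 → Matrix (Fin 2) (Fin 2) ℂ => ((frameAccU (K - n) (bgUnits F K U₀) (fun b => expUnit (A b) * bgUnits F K U₀ b) (bondShift (sites_eq F n K h) c).src : (Matrix (Fin 2) (Fin 2) ℂ)ˣ) : Matrix (Fin 2) (Fin 2) ℂ)) 0 Y - (fderiv ℂ (fderiv ℂ (fun A : PBond (F.P K) 0 → Matrix (Fin 2) (Fin 2) ℂ => ((frameAccU (K - n) (bgUnits F K U₀) (fun b => expUnit (A b) * bgUnits F K U₀ b)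 (bondShift (sites_eq F n K h) c).src : (Matrix (Fin 2) (Fin 2) ℂ)ˣ) : Matrix (Fin 2) (Fin 2) ℂ))) 0 Y (fun b : PBond (F.P K) 0 => N b.src - ((bgUnits F K U₀ b : (Matrix (Fin 2) (Fin 2) ℂ)ˣ) : Matrix (Fin 2) (Fin 2) ℂ) * N b.tgt * (((bgUnits F K U₀ b)⁻¹ : (Matrix (Fin 2) (Fin 2) ℂ)ˣ) : Matrix (Fin 2) (Fin 2) ℂ)) + fderiv ℂ (fun A : PBond (F.P K) 0 → Matrix (Fin 2) (Fin 2) ℂ => ((frameAccU (K - n) (bgUnits F K U₀) (fun b => expUnit (A b) * bgUnits F K U₀ b) (bondShift (sites_eq F n K h) c).src : (Matrix (Fin 2) (Fin 2) ℂ)ˣ) : Matrix (Fin 2) (Fin 2) ℂ)) 0 (fun b : PBond (F.P K) 0 => (2 : ℂ)⁻¹ • ((N b.src + ((bgUnits F K U₀ b : (Matrix (Fin 2) (Fin 2) ℂ)ˣ) : Matrix (Fin 2) (Fin 2) ℂ) * N b.tgt * (((bgUnits F K U₀ b)⁻¹ : (Matrix (Fin 2) (Fin 2) ℂ)ˣ)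 : Matrix (Fin 2) (Fin 2) ℂ)) * Y b - Y b * (N b.src + ((bgUnits F K U₀ b : (Matrix (Fin 2) (Fin 2) ℂ)ˣ) : Matrix (Fin 2) (Fin 2) ℂ) * N b.tgt * (((bgUnits F K U₀ b)⁻¹ : (Matrix (Fin 2) (Fin 2) ℂ)ˣ) : Matrix (Fin 2) (Fin 2) ℂ))))))) (kt := ((ns (K - n) (bondShift (sites_eq F n K h) c).tgt * fderiv ℂ (fun A : PBond (F.P K) 0 → Matrix (Fin 2) (Fin 2) ℂ => ((frameAccU (K - n) (bgUnits F K U₀) (fun b => expUnit (A b) * bgUnits F K U₀ b) (bondShift (sites_eq F n K h) c).tgt : (Matrix (Fin 2) (Fin 2) ℂ)ˣ) : Matrix (Fin 2) (Fin 2) ℂ)) 0 Y - fderiv ℂ (fun A : PBond (F.P K) 0 → Matrix (Fin 2) (Fin 2) ℂ => ((frameAccU (K - n) (bgUnits F K U₀) (fun b => expUnit (A b) * bgUnits F K U₀ b) (bondShift (sites_eq F n K h) c).tgt : (Matrix (Fin 2) (Fin 2) ℂ)ˣ) : Matrix (Fin 2) (Fin 2) ℂ)) 0 Y * ns (K - n)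 (bondShift (sites_eq F n K h) c).tgt) + (N (embIter (K - n) (bondShift (sites_eq F n K h) c).tgt) - ns (K - n) (bondShift (sites_eq F n K h) c).tgt) * fderiv ℂ (fun A : PBond (F.P K) 0 → Matrix (Fin 2) (Fin 2) ℂ => ((frameAccU (K - n) (bgUnits F K U₀) (fun b => expUnit (A b) * bgUnits F K U₀ b) (bondShift (sites_eq F n K h) c).tgt : (Matrix (Fin 2) (Fin 2) ℂ)ˣ) : Matrix (Fin 2) (Fin 2) ℂ)) 0 Y - (fderiv ℂ (fderiv ℂ (fun A : PBond (F.P K) 0 → Matrix (Fin 2) (Fin 2) ℂ => ((frameAccU (K - n) (bgUnits F K U₀) (fun b => expUnit (A b) * bgUnits F K U₀ b) (bondShift (sites_eq F n K h) c).tgt : (Matrix (Fin 2) (Fin 2) ℂ)ˣ) : Matrix (Fin 2) (Fin 2) ℂ))) 0 Y (fun b : PBond (F.P K) 0 => N b.src - ((bgUnits F K U₀ b : (Matrix (Fin 2) (Fin 2) ℂ)ˣ) : Matrix (Fin 2) (Fin 2) ℂ) * N b.tgt * (((bgUnits F K U₀ b)⁻¹ : (Matrix (Fin 2) (Fin 2)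 ℂ)ˣ) : Matrix (Fin 2) (Fin 2) ℂ)) + fderiv ℂ (fun A : PBond (F.P K) 0 → Matrix (Fin 2) (Fin 2) ℂ => ((frameAccU (K - n) (bgUnits F K U₀) (fun b => expUnit (A b) * bgUnits F K U₀ b) (bondShift (sites_eq F n K h) c).tgt : (Matrix (Fin 2) (Fin 2) ℂ)ˣ) : Matrix (Fin 2) (Fin 2) ℂ)) 0 (fun b : PBond (F.P K) 0 => (2 : ℂ)⁻¹ • ((N b.src + ((bgUnits F K U₀ b : (Matrix (Fin 2) (Fin 2) ℂ)ˣ) : Matrix (Fin 2) (Fin 2) ℂ) * N b.tgt * (((bgUnits F K U₀ b)⁻¹ : (Matrix (Fin 2) (Fin 2) ℂ)ˣ) : Matrix (Fin 2) (Fin 2) ℂ)) * Y b - Y b * (N b.src + ((bgUnits F K U₀ b : (Matrix (Fin 2) (Fin 2) ℂ)ˣ) : Matrix (Fin 2) (Fin 2) ℂ) * N b.tgt * (((bgUnits F K U₀ b)⁻¹ : (Matrix (Fin 2) (Fin 2) ℂ)ˣ) : Matrix (Fin 2) (Fin 2) ℂ))))))) heq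

/-- ★★★ **✓p774022's LETTER `h2` INHABITED (member)**: at `RegPr F n K ε₀ U₀`, `10¹²L³ε₀ ≤ 1`, for every family `ns x A` of averaging sequences of the site spikes `δ_x⊗A` (`h0`, `hsucc` — the letters of
✓`Prop7AvgHessGaugeIdentityNormReading` §3), the pointwise identity (2) holds for all `Y x A c` with the EXPLICIT `κY Y x A z` of §2 at `N := δ_x⊗A` — so ✓`hId_of_pointwise_identity`,
✓`gaugeDir_column_of_pointwise_identity_and_FR2` and ✓`hqG_member_of_pointwise_identity_and_FR2` consume it by `exact`, leaving «FR₂-lite» (the site-mass row of this `κY`) as the ONLY open input of `hqG`.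
[cite: Balaban1985BackgroundPropagators, (3.114)–(3.115) p.418, (3.19) p.393; Balaban1985Averaging, (11) p.19, (97) p.32, Prop. 5 (157) p.42] -/
theorem h2_of_regPr {ε₀ : ℝ} (hε₀ : 0 < ε₀) (hWε : 10 ^ 12 * (F.L : ℝ) ^ 3 * ε₀ ≤ 1)
    (U₀ : GaugeField (F.P K) 0 (Matrix.specialUnitaryGroup (Fin 2) ℂ)) (hreg : RegPr F n K ε₀ U₀)
    (ns : Site (F.P K) 0 → Matrix (Fin 2) (Fin 2) ℂ → (j : ℕ) → Site (F.P K) j → Matrix (Fin 2) (Fin 2) ℂ)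
    (h0 : ∀ (x : Site (F.P K) 0) (A : Matrix (Fin 2) (Fin 2) ℂ), ns x A 0 = Pi.single x A)
    (hsucc : ∀ (x : Site (F.P K) 0) (A : Matrix (Fin 2) (Fin 2) ℂ) (j : ℕ) (y : Site (F.P K) (j + 1)), ns x A (j + 1) y = ns x A j (emb y) - meanCLM (Idx (F.P K)) (Matrix (Fin 2) (Fin 2) ℂ) fun r : Idx (F.P K) =>
        ns x A j (emb y) - ((holT (emlIterU j (bgUnits F K U₀)) (emb y) (stairWord r.2.1 (off r.1)) : (Matrix (Fin 2) (Fin 2) ℂ)ˣ) : Matrix (Fin 2) (Fin 2) ℂ) *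
          ns x A j (transl (emb y) (disp (stairWord r.2.1 (off r.1)))) * (((holT (emlIterU j (bgUnits F K U₀)) (emb y) (stairWord r.2.1 (off r.1)))⁻¹ : (Matrix (Fin 2) (Fin 2) ℂ)ˣ) : Matrix (Fin 2) (Fin 2) ℂ)) :
    ∀ (Y : PBond (F.P K) 0 → Matrix (Fin 2) (Fin 2) ℂ) (x : Site (F.P K) 0) (A : Matrix (Fin 2) (Fin 2) ℂ) (c : PBond (F.P n) 0),
      avgHess F n K h U₀ Y (fun b : PBond (F.P K) 0 => (Pi.single x A : Site (F.P K) 0 → Matrix (Fin 2) (Fin 2) ℂ) b.src - ((bgUnits F K U₀ b : (Matrix (Fin 2) (Fin 2) ℂ)ˣ) : Matrix (Fin 2) (Fin 2) ℂ) * (Pi.single x A : Site (F.P K) 0 → Matrix (Fin 2) (Fin 2) ℂ) b.tgt * (((bgUnits F K U₀ b)⁻¹ : (Matrix (Fin 2) (Fin 2) ℂ)ˣ) : Matrix (Fin 2) (Fin 2) ℂ)) c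
        = -((2 : ℂ)⁻¹ • QTwS F n K h U₀ (fun b : PBond (F.P K) 0 => ((Pi.single x A : Site (F.P K) 0 → Matrix (Fin 2) (Fin 2) ℂ) b.src + ((bgUnits F K U₀ b : (Matrix (Fin 2) (Fin 2) ℂ)ˣ) : Matrix (Fin 2) (Fin 2) ℂ) * (Pi.single x A : Site (F.P K) 0 → Matrix (Fin 2) (Fin 2) ℂ) b.tgt * (((bgUnits F K U₀ b)⁻¹ : (Matrix (Fin 2) (Fin 2) ℂ)ˣ) : Matrix (Fin 2) (Fin 2) ℂ)) * Y b - Y b * ((Pi.single x A : Site (F.P K) 0 → Matrix (Fin 2) (Fin 2) ℂ) b.src + ((bgUnits F K U₀ b : (Matrix (Fin 2) (Fin 2) ℂ)ˣ) : Matrix (Fin 2) (Fin 2) ℂ) * (Pi.single x A : Site (F.P K) 0 → Matrix (Fin 2) (Fin 2) ℂ) b.tgt * (((bgUnits F K U₀ b)⁻¹ : (Matrix (Fin 2) (Fin 2) ℂ)ˣ) : Matrix (Fin 2) (Fin 2) ℂ))) c)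
          + (2 : ℂ)⁻¹ • ((ns x A (K - n) (bondShift (sites_eq F n K h) c).src + ((emlIterU (K - n) (bgUnits F K U₀) (bondShift (sites_eq F n K h) c) : (Matrix (Fin 2) (Fin 2) ℂ)ˣ) : Matrix (Fin 2) (Fin 2) ℂ) * ns x A (K - n) (bondShift (sites_eq F n K h) c).tgt * (((emlIterU (K - n) (bgUnits F K U₀) (bondShift (sites_eq F n K h) c))⁻¹ : (Matrix (Fin 2) (Fin 2) ℂ)ˣ) : Matrix (Fin 2) (Fin 2) ℂ)) * QTwS F n K h U₀ Y c - QTwS F n K h U₀ Y c * (ns x A (K - n) (bondShift (sites_eq F n K h) c).src + ((emlIterU (K - n) (bgUnits F K U₀) (bondShift (sites_eq F n K h) c) : (Matrix (Fin 2) (Fin 2) ℂ)ˣ) : Matrix (Fin 2) (Fin 2) ℂ) * ns x A (K - n) (bondShift (sites_eq F n K h) c).tgt * (((emlIterU (K - n) (bgUnits F K U₀) (bondShift (sites_eq F n K h) c))⁻¹ : (Matrix (Fin 2) (Fin 2) ℂ)ˣ) : Matrix (Fin 2) (Fin 2) ℂ)))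
          + (((ns x A (K - n) (bondShift (sites_eq F n K h) c).src * fderiv ℂ (fun A : PBond (F.P K) 0 → Matrix (Fin 2) (Fin 2) ℂ => ((frameAccU (K - n) (bgUnits F K U₀) (fun b => expUnit (A b) * bgUnits F K U₀ b) (bondShift (sites_eq F n K h) c).src : (Matrix (Fin 2) (Fin 2) ℂ)ˣ) : Matrix (Fin 2) (Fin 2) ℂ)) 0 Y - fderiv ℂ (fun A : PBond (F.P K) 0 → Matrix (Fin 2) (Fin 2) ℂ => ((frameAccU (K - n) (bgUnits F K U₀) (fun b => expUnit (A b) * bgUnits F K U₀ b) (bondShift (sites_eq F n K h) c).src : (Matrix (Fin 2) (Fin 2) ℂ)ˣ) : Matrix (Fin 2) (Fin 2) ℂ)) 0 Y * ns x A (K - n) (bondShift (sites_eq F n K h) c).src) + ((Pi.single x A : Site (F.P K) 0 → Matrix (Fin 2) (Fin 2) ℂ) (embIter (K - n) (bondShift (sites_eq F n K h) c).src) - ns x A (K - n) (bondShift (sites_eq F n K h) c).src) * fderiv ℂ (fun A : PBond (F.P K) 0 → Matrix (Fin 2) (Fin 2) ℂ => ((frameAccU (K - n) (bgUnits F K U₀)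 (fun b => expUnit (A b) * bgUnits F K U₀ b) (bondShift (sites_eq F n K h) c).src : (Matrix (Fin 2) (Fin 2) ℂ)ˣ) : Matrix (Fin 2) (Fin 2) ℂ)) 0 Y - (fderiv ℂ (fderiv ℂ (fun A : PBond (F.P K) 0 → Matrix (Fin 2) (Fin 2) ℂ => ((frameAccU (K - n) (bgUnits F K U₀) (fun b => expUnit (A b) * bgUnits F K U₀ b) (bondShift (sites_eq F n K h) c).src : (Matrix (Fin 2) (Fin 2) ℂ)ˣ) : Matrix (Fin 2) (Fin 2) ℂ))) 0 Y (fun b : PBond (F.P K) 0 => (Pi.single x A : Site (F.P K) 0 → Matrix (Fin 2) (Fin 2) ℂ) b.src - ((bgUnits F K U₀ b : (Matrix (Fin 2) (Fin 2) ℂ)ˣ) : Matrix (Fin 2) (Fin 2) ℂ) * (Pi.single x A : Site (F.P K) 0 → Matrix (Fin 2) (Fin 2) ℂ) b.tgt * (((bgUnits F K U₀ b)⁻¹ : (Matrix (Fin 2) (Fin 2) ℂ)ˣ) : Matrix (Fin 2) (Fin 2) ℂ)) + fderiv ℂ (fun A : PBond (F.P K) 0 → Matrix (Fin 2) (Fin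 2) ℂ => ((frameAccU (K - n) (bgUnits F K U₀) (fun b => expUnit (A b) * bgUnits F K U₀ b) (bondShift (sites_eq F n K h) c).src : (Matrix (Fin 2) (Fin 2) ℂ)ˣ) : Matrix (Fin 2) (Fin 2) ℂ)) 0 (fun b : PBond (F.P K) 0 => (2 : ℂ)⁻¹ • (((Pi.single x A : Site (F.P K) 0 → Matrix (Fin 2) (Fin 2) ℂ) b.src + ((bgUnits F K U₀ b : (Matrix (Fin 2) (Fin 2) ℂ)ˣ) : Matrix (Fin 2) (Fin 2) ℂ) * (Pi.single x A : Site (F.P K) 0 → Matrix (Fin 2) (Fin 2) ℂ) b.tgt * (((bgUnits F K U₀ b)⁻¹ : (Matrix (Fin 2) (Fin 2) ℂ)ˣ) : Matrix (Fin 2) (Fin 2) ℂ)) * Y b - Y b * ((Pi.single x A : Site (F.P K) 0 → Matrix (Fin 2) (Fin 2) ℂ) b.src + ((bgUnits F K U₀ b : (Matrix (Fin 2) (Fin 2) ℂ)ˣ) : Matrix (Fin 2) (Fin 2) ℂ) * (Pi.single x A : Site (F.P K) 0 → Matrix (Fin 2) (Fin 2) ℂ) b.tgt * (((bgUnits F K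 U₀ b)⁻¹ : (Matrix (Fin 2) (Fin 2) ℂ)ˣ) : Matrix (Fin 2) (Fin 2) ℂ)))))) - ((emlIterU (K - n) (bgUnits F K U₀) (bondShift (sites_eq F n K h) c) : (Matrix (Fin 2) (Fin 2) ℂ)ˣ) : Matrix (Fin 2) (Fin 2) ℂ) * ((ns x A (K - n) (bondShift (sites_eq F n K h) c).tgt * fderiv ℂ (fun A : PBond (F.P K) 0 → Matrix (Fin 2) (Fin 2) ℂ => ((frameAccU (K - n) (bgUnits F K U₀) (fun b => expUnit (A b) * bgUnits F K U₀ b) (bondShift (sites_eq F n K h) c).tgt : (Matrix (Fin 2) (Fin 2) ℂ)ˣ) : Matrix (Fin 2) (Fin 2) ℂ)) 0 Y - fderiv ℂ (fun A : PBond (F.P K) 0 → Matrix (Fin 2) (Fin 2) ℂ => ((frameAccU (K - n) (bgUnits F K U₀) (fun b => expUnit (A b) * bgUnits F K U₀ b) (bondShift (sites_eq F n K h) c).tgt : (Matrix (Fin 2) (Fin 2) ℂ)ˣ) : Matrix (Fin 2) (Fin 2) ℂ)) 0 Y * ns x A (K - n) (bondShift (sites_eq F n K h) c).tgt) + ((Pi.single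 x A : Site (F.P K) 0 → Matrix (Fin 2) (Fin 2) ℂ) (embIter (K - n) (bondShift (sites_eq F n K h) c).tgt) - ns x A (K - n) (bondShift (sites_eq F n K h) c).tgt) * fderiv ℂ (fun A : PBond (F.P K) 0 → Matrix (Fin 2) (Fin 2) ℂ => ((frameAccU (K - n) (bgUnits F K U₀) (fun b => expUnit (A b) * bgUnits F K U₀ b) (bondShift (sites_eq F n K h) c).tgt : (Matrix (Fin 2) (Fin 2) ℂ)ˣ) : Matrix (Fin 2) (Fin 2) ℂ)) 0 Y - (fderiv ℂ (fderiv ℂ (fun A : PBond (F.P K) 0 → Matrix (Fin 2) (Fin 2) ℂ => ((frameAccU (K - n) (bgUnits F K U₀) (fun b => expUnit (A b) * bgUnits F K U₀ b) (bondShift (sites_eq F n K h) c).tgt : (Matrix (Fin 2) (Fin 2) ℂ)ˣ) : Matrix (Fin 2) (Fin 2) ℂ))) 0 Y (fun b : PBond (F.P K) 0 => (Pi.single x A : Site (F.P K) 0 → Matrix (Fin 2) (Fin 2) ℂ) b.src - ((bgUnits F K U₀ b : (Matrix (Fin 2) (Fin 2) ℂ)ˣ) : Matrix (Fin 2) (Fin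 2) ℂ) * (Pi.single x A : Site (F.P K) 0 → Matrix (Fin 2) (Fin 2) ℂ) b.tgt * (((bgUnits F K U₀ b)⁻¹ : (Matrix (Fin 2) (Fin 2) ℂ)ˣ) : Matrix (Fin 2) (Fin 2) ℂ)) + fderiv ℂ (fun A : PBond (F.P K) 0 → Matrix (Fin 2) (Fin 2) ℂ => ((frameAccU (K - n) (bgUnits F K U₀) (fun b => expUnit (A b) * bgUnits F K U₀ b) (bondShift (sites_eq F n K h) c).tgt : (Matrix (Fin 2) (Fin 2) ℂ)ˣ) : Matrix (Fin 2) (Fin 2) ℂ)) 0 (fun b : PBond (F.P K) 0 => (2 : ℂ)⁻¹ • (((Pi.single x A : Site (F.P K) 0 → Matrix (Fin 2) (Fin 2) ℂ) b.src + ((bgUnits F K U₀ b : (Matrix (Fin 2) (Fin 2) ℂ)ˣ) : Matrix (Fin 2) (Fin 2) ℂ) * (Pi.single x A : Site (F.P K) 0 → Matrix (Fin 2) (Fin 2) ℂ) b.tgt * (((bgUnits F K U₀ b)⁻¹ : (Matrix (Fin 2) (Fin 2) ℂ)ˣ) : Matrix (Fin 2) (Fin 2) ℂ)) * Y b - Y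 b * ((Pi.single x A : Site (F.P K) 0 → Matrix (Fin 2) (Fin 2) ℂ) b.src + ((bgUnits F K U₀ b : (Matrix (Fin 2) (Fin 2) ℂ)ˣ) : Matrix (Fin 2) (Fin 2) ℂ) * (Pi.single x A : Site (F.P K) 0 → Matrix (Fin 2) (Fin 2) ℂ) b.tgt * (((bgUnits F K U₀ b)⁻¹ : (Matrix (Fin 2) (Fin 2) ℂ)ˣ) : Matrix (Fin 2) (Fin 2) ℂ)))))) * (((emlIterU (K - n) (bgUnits F K U₀) (bondShift (sites_eq F n K h) c))⁻¹ : (Matrix (Fin 2) (Fin 2) ℂ)ˣ) : Matrix (Fin 2) (Fin 2) ℂ)) :=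
  fun Y x A c => avgHess_gaugeDir_apply F h hε₀ hWε U₀ hreg Y (Pi.single x A : Site (F.P K) 0 → Matrix (Fin 2) (Fin 2) ℂ) (ns x A) (h0 x A) (hsucc x A) c

end Main


end Summit.QuantumFields.YangMills.Theorems.Prop7AvgHessGaugePointwiseIdentity

end
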